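import Literature.AlgebraicGeometry.Modules.IsZeroOfAffineCover
import Literature.AlgebraicGeometry.Morphisms.CohAffineExactness
import Literature.AlgebraicGeometry.Modules.IdealSheafNoetherian
import Mathlib.RingTheory.Noetherian.Basic
import HarnessLib

/-!
# A chain of quotients of a coherent module on a noetherian scheme stabilises

Let `X` be a noetherian scheme (locally noetherian and quasi-compact), `M` a coherent `𝒪_X`-module
and `M ↠ G_0 ↠ G_1 ↠ G_2 ↠ ⋯` a chain of epimorphisms of coherent modules, i.e. epimorphisms
`ψ_n : M → G_n` and maps `μ_n : G_n → G_{n+1}` with `ψ_n ≫ μ_n = ψ_{n+1}`. Then **`μ_n` is an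
isomorphism for all `n ≫ 0`** (`exists_forall_isIso_of_epi_chain`): over each member `V` of a finite
affine open cover the kernels `ker(Γ(V, M) → Γ(V, G_n))` form an ascending chain of submodules of
the noetherian module `Γ(V, M)` (finitely generated over the noetherian ring `Γ(V, 𝒪_X)`), hence
stabilise; past the (finite) maximum of the stabilisation indices each `μ_n` is injective on the
sections over the cover, hence a monomorphism (`Modules/IsZeroOfAffineCover.mono_of_app_injective_of_cover`),
and it is an epimorphism anyway.

This is the noetherian finiteness behind the uniform vanishing / generation statements for the
graded pieces `aⁿℱ_n` of a coherent formal module along a principal ideal (Görtz–Wedhorn II,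
Prop. 24.102, proof; EGA III₁ 5.2), where the pieces form such a chain of quotients of `ℱ_0`.
Everything is proved; no named facts.

## References

* R. Hartshorne, *Algebraic Geometry*, GTM 52 (1977), II Prop. 5.7, Ex. 5.? (noetherian induction on
  coherent sheaves). [Hartshorne1977]
* U. Görtz, T. Wedhorn, *Algebraic Geometry II* (2023), Prop. 24.102 (p. 569). [GortzWedhorn2023]
-/

noncomputable section

open CategoryTheory AlgebraicGeometry Limits TopologicalSpace Opposite
open Literature.AlgebraicGeometry.Morphisms

universe u

namespace Literature.AlgebraicGeometry.Modules

variable {X : Scheme.{u}}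

/-- The kernels `ker(Γ(V, M) → Γ(V, G_n))` of a chain of quotients form an ascending chain.
[folklore] -/
def epiChainKer {M : X.Modules} {G : ℕ → X.Modules} (ψ : ∀ n, M ⟶ G n) (μ : ∀ n, G n ⟶ G (n + 1))
    (hμ : ∀ n, ψ n ≫ μ n = ψ (n + 1)) (V : X.Opens) : ℕ →o Submodule Γ(X, V) Γ(M, V) where
  toFun n := LinearMap.ker (appLinear (ψ n) V)
  monotone' := monotone_nat_of_le_succ fun n x hx => by
    rw [LinearMap.mem_ker] at hx ⊢
    change (ψ (n + 1)).app V x = 0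
    rw [← hμ n]
    change (μ n).app V ((ψ n).app V x) = 0
    rw [show (ψ n).app V x = 0 from hx, map_zero]

/-- The `n`-th member of the chain of kernels. [folklore] -/
theorem mem_epiChainKer_iff {M : X.Modules} {G : ℕ → X.Modules} (ψ : ∀ n, M ⟶ G n)
    (μ : ∀ n, G n ⟶ G (n + 1)) (hμ : ∀ n, ψ n ≫ μ n = ψ (n + 1)) (V : X.Opens) (n : ℕ)
    (x : Γ(M, V)) : x ∈ epiChainKer ψ μ hμ V n ↔ (ψ n).app V x = 0 :=
  Iff.rfl

/-- **A chain of quotients of a coherent module on a noetherian scheme stabilises.**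
[cite: GortzWedhorn2023, Prop. 24.102, proof (p. 569)] -/
theorem exists_forall_isIso_of_epi_chain [IsLocallyNoetherian X] [CompactSpace X]
    {M : X.Modules} (hM : Coh M) {G : ℕ → X.Modules} (hG : ∀ n, Coh (G n))
    (ψ : ∀ n, M ⟶ G n) (hψ : ∀ n, Epi (ψ n)) (μ : ∀ n, G n ⟶ G (n + 1))
    (hμ : ∀ n, ψ n ≫ μ n = ψ (n + 1)) : ∃ n₀, ∀ n, n₀ ≤ n → IsIso (μ n) := by
  classical
  obtain ⟨T, hT⟩ := exists_finite_affineOpens_iSup_eq_top (X := X)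
  -- stabilisation index over each member of the cover
  have hstab : ∀ V : T, ∃ n₀, ∀ m, n₀ ≤ m →
      epiChainKer ψ μ hμ ((V : X.affineOpens) : X.Opens) n₀ =
        epiChainKer ψ μ hμ ((V : X.affineOpens) : X.Opens) m := fun V => by
    haveI : IsNoetherianRing Γ(X, ((V : X.affineOpens) : X.Opens)) :=
      IsLocallyNoetherian.component_noetherian (V : X.affineOpens)
    haveI : Module.Finite Γ(X, ((V : X.affineOpens) : X.Opens))
        Γ(M, ((V : X.affineOpens) : X.Opens)) := hM.ft (V : X.affineOpens).2
    exact monotone_stabilizes_iff_noetherian.mpr inferInstance (epiChainKer ψ μ hμ _)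
  choose nV hnV using hstab
  refine ⟨Finset.univ.sup nV, fun n hn => ?_⟩
  have hle : ∀ V : T, nV V ≤ n := fun V => le_trans (Finset.le_sup (Finset.mem_univ V)) hn
  -- `μ n` is a monomorphism: injective on the sections over the cover
  haveI : Mono (μ n) := by
    refine mono_of_app_injective_of_cover (μ n) (hG n).loc (hG (n + 1)).loc
      (fun V : T => ((V : X.affineOpens) : X.Opens)) (fun V => (V : X.affineOpens).2) hT
      fun V => (injective_iff_map_eq_zero _).mpr fun y hy => ?_
    haveI := hψ n
    obtain ⟨x, rfl⟩ := app_surjective_of_epi (ψ n) hM.loc (hG n).loc (V : X.affineOpens).2 y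
    have hx : x ∈ epiChainKer ψ μ hμ ((V : X.affineOpens) : X.Opens) (n + 1) := by
      rw [mem_epiChainKer_iff, ← hμ n]
      exact hy
    rw [← hnV V (n + 1) (Nat.le_succ_of_le (hle V)), hnV V n (hle V), mem_epiChainKer_iff] at hx
    exact hx
  -- and an epimorphism
  haveI : Epi (μ n) := by
    haveI := hψ (n + 1)
    have h : Epi (ψ n ≫ μ n) := by rw [hμ n]; infer_instance
    exact epi_of_epi (ψ n) _
  exact isIso_of_mono_of_epi _

end Literature.AlgebraicGeometry.Modules

end
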